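import Literature.MathematicalPhysics.QuantumLattice.HubbardNNNHoppingCorrelatorWindowCertificate
import Literature.MathematicalPhysics.QuantumLattice.InfVolFermionStateTorusLimitLocalStability
import Literature.MathematicalPhysics.QuantumManyBody.StateRelaxationKKT
import HarnessLib

/-!
# Rung R3/R4 — `t–t'` window certificate rows WITH a state-optimality (KKT) block, read in the
# space-group-averaged state of every sector ground state of every large torus (uniform in `L`)

HONEST FRAMING (page 1): ladder R1–R4 with certified numbers; no claim on H/H₀.

Block kind `kkt` (pseudo seat, family F4) for the `t–t'` WINDOW certificate format of
`Literature.….HubbardNNNHoppingCorrelatorWindowCertificate`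
(`re_orbitState_ge_of_window_certificate_d4_TT'_ineq`: one identity in the CAR algebra `𝔄_{Λ'}` of a
finite window, objective `X ∈ 𝔄_{Λ'}`, energy constraint `κ (u·1 − Γ(incl) E^{tt'}_Φ)`, affine `D₄`
reductions over a point-group set `S`, read in the orbit state `ω̄_ψ = orbitState (U_w D_γ)_{w, γ ∈ S} ψ`
of a vector `ψ` of the torus `(ℤ/Lℤ)²`). That row holds for every EIGENVECTOR `ψ`; the KKT summand
`kktForm H^{tt'}_{Λ'} G B̃ = Σ_ab G_ab • (B̃_aᴴ (H^{tt'}_{Λ'} B̃_b − B̃_b H^{tt'}_{Λ'}))`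
(`Literature.….StateRelaxation.kktForm`; WINDOW Hamiltonian `H^{tt'}_{Λ'}` of
`hubbardTTPrimeFermionInteraction t t' U`, multiplier `G ⪰ 0`, generators `B̃_b = Γ(incl) B_b` with
`B_b ∈ 𝔄_Λ` supported in the inner region `Λ` (`thicken Λ 1 ⊆ Λ'`) and conserving the local particle
number and `S^z`) is a nonnegative residual for sector GROUND states only:

* §1 (finite-dimensional, generic): the orbit state `ω̄_ψ` over a finite family `T_g` commuting with
  a Hermitian `A`, with `T_gᴴ T_g = 1`-type sector preservation `T_gᴴ K ⊆ K`, of a sector ground state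
  `ψ ∈ K`, `A ψ = E_K ψ`, obeys the ground-state inequality `Re ω̄_ψ(Cᴴ (A C − C A)) ≥ 0` for every
  `C` mapping `K` into `K` (`re_orbitState_conjTranspose_mul_commutator_nonneg_of_sectorGS`: every
  orbit vector `T_gᴴ ψ` is again a sector ground state; Bratteli–Robinson II Prop. 5.3.19 via
  `star_dotProduct_conjTranspose_mul_commutator_mulVec_nonneg`), hence
  `Re ω̄_ψ(kktForm A G B) ≥ 0` (`re_orbitState_kktForm_nonneg_of_sectorGS`, weak duality
  `re_map_kktForm_nonneg`).
* §2 (the `t–t'` tori): the pulled-back window KKT element has nonnegative real part in `ω̄_ψ` for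
  every ground state `ψ` of a joint sector `(2n, S^z = 0)` of `hubbardTorusTT' L t t' U`
  (`re_orbitState_fermionEmbed_kktForm_TT'_nonneg`; `Γ(H^{tt'}_{Λ'} B̃ − B̃ H^{tt'}_{Λ'}) =
  H ΓB̃ − ΓB̃ H` by `hubbardTorusTT'_commutator_fermionEmbed`, `U_w D_γ` commute with `H` and
  preserve the sectors). Rows: `re_orbitState_ge_of_window_certificate_d4_TT'_kkt_ineq`
  (`c − Σₖ ‖aₖ‖ + (Σ_σ μ_σ)(n/L² − ν) + κ (u − E₀(2n)/L²) ≤ Re ω̄_ψ(Γ(ι_{Λ',L}) X)` for every unit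
  ground state `ψ` of the sector, every `L ≥ 3` with `x ↦ x mod L` injective on `thicken Λ' 1`) and,
  with `κ ≥ 0` and a certified `E₀(2n)/L² ≤ u`, `re_orbitState_ge_of_window_certificate_d4_TT'_groundState_kkt`
  (`c − Σₖ ‖aₖ‖ + (Σ_σ μ_σ)(n/L² − ν) ≤ Re ω̄_ψ(Γ X)`) — UNIFORM IN `L`, any filling, every vector of a
  degenerate ground level: the form used by finite-size correlator tables at `t' ≠ 0`.

Validity, exactly as proved: finite tori (no thermodynamic-limit statement for `t' ≠ 0` observables
is in the tree); generators conserve `N̂` and `S^z` and are supported in `Λ` with `thicken Λ 1 ⊆ Λ'`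
(next-nearest-neighbour hopping needs the diagonal neighbours); `G ⪰ 0`; sector GROUND states (an
excited eigenvector violates the block). The `t' = 0` rows (nearest-neighbour windows incl. the
thermodynamic limit) are in `KKTWindowRowsTL`; the torus-mode rows in `KKTWindowRows`. No
certificate is contained in this file.

## References
* O. Bratteli, D. W. Robinson, *Operator Algebras and Quantum Statistical Mechanics 2*, 2nd ed.
  (1997), Prop. 5.3.19, §6.2.4. [cite: BratteliRobinsonII1997, Prop. 5.3.19]
* J. Wang et al., PRX 14 (2024) 031006, §III. [cite: WangEtAl2024, §III]
* M. Araújo, I. Klep, A. J. P. Garner, T. Vértesi, M. Navascués, arXiv:2311.18707, §3.2 Prop. 11.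
  [cite: AraujoEtAl2023, §3.2 Prop. 11]
* M. G. Scheer, N. Chadha, D.-C. Lu, E. Khalaf, arXiv:2511.20860, §II eq. (2).
  [cite: ScheerEtAl2025, §II eq. (2)]
* X. Han, arXiv:2006.06002 (2020), §3. [cite: Han2020Bootstrap, §3]
* H. Xu et al., Science 384 (2024) eadh7691, eq. (1). [cite: XuEtAl2024, eq. (1)]
-/

noncomputable section

namespace Summit.HubbardSuperconductivity.HubbardLadder

open Literature.MathematicalPhysics.QuantumLattice Literature.Probability.LatticeModels
  Literature.MathematicalPhysics.QuantumManyBody.StateRelaxation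
open Matrix Finset
open scoped ComplexOrder BigOperators

/-! ## §1 Orbit states of sector ground states: the ground-state inequality and KKT blocks -/

section OrbitKKT

variable {n : Type*} [Fintype n] [DecidableEq n] {Gp : Type*} [Fintype Gp]
variable {m : Type*} [Fintype m] [DecidableEq m]

/-- **The ground-state inequality in the orbit state of a sector ground state.** `A` Hermitian, `K`
a sector, `T_g` a finite family with `T_g A = A T_g` and `T_gᴴ K ⊆ K`, `ψ ∈ K` with `A ψ = E_K ψ`
(`E_K = minEnergyOn A K`), and `C` mapping `K` into `K`. Then
`0 ≤ Re ω̄_ψ(Cᴴ (A C − C A))`, `ω̄_ψ = orbitState T ψ` — every orbit vector `T_gᴴ ψ` lies in `K`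
with `A T_gᴴ ψ = E_K T_gᴴ ψ`, and the vector inequality (Bratteli–Robinson II Prop. 5.3.19,
sector-wise) is averaged. [cite: BratteliRobinsonII1997, Prop. 5.3.19] -/
theorem re_orbitState_conjTranspose_mul_commutator_nonneg_of_sectorGS {A C : Matrix n n ℂ}
    (hA : A.IsHermitian) (K : Submodule ℂ (n → ℂ)) (hC : ∀ w ∈ K, C *ᵥ w ∈ K)
    {T : Gp → Matrix n n ℂ} (hTA : ∀ g, T g * A = A * T g) (hTK : ∀ g, ∀ w ∈ K, (T g)ᴴ *ᵥ w ∈ K)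
    {ψ : n → ℂ} (hψK : ψ ∈ K) (hAψ : A *ᵥ ψ = ((A.minEnergyOn K : ℝ) : ℂ) • ψ) :
    0 ≤ (orbitState T ψ (Cᴴ * (A * C - C * A))).re := by
  have hg : ∀ g, A *ᵥ ((T g)ᴴ *ᵥ ψ) = ((A.minEnergyOn K : ℝ) : ℂ) • ((T g)ᴴ *ᵥ ψ) := fun g => by
    have hc : A * (T g)ᴴ = (T g)ᴴ * A := by
      have h := congrArg Matrix.conjTranspose (hTA g)
      rwa [conjTranspose_mul, conjTranspose_mul, hA.eq] at h
    rw [mulVec_mulVec, hc, ← mulVec_mulVec, hAψ, mulVec_smul]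
  rw [orbitState_apply, ← Complex.ofReal_natCast, ← Complex.ofReal_inv, Complex.re_ofReal_mul,
    Complex.re_sum]
  exact mul_nonneg (inv_nonneg.2 (Nat.cast_nonneg _)) (Finset.sum_nonneg fun g _ => by
    rw [Literature.MathematicalPhysics.QuantumManyBody.StateRelaxation.vectorState_apply]
    exact (Complex.nonneg_iff.mp (star_dotProduct_conjTranspose_mul_commutator_mulVec_nonneg hA K hC
      (hTK g ψ hψK) (hg g))).1)

/-- **KKT block ⇒ nonnegative in the orbit state of a sector ground state.** Under the hypotheses
of `re_orbitState_conjTranspose_mul_commutator_nonneg_of_sectorGS`, for a multiplier `G ⪰ 0` and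
generators `B_b` mapping `K` into `K`: `0 ≤ Re ω̄_ψ(kktForm A G B)` (factor `G = Lᴴ L`,
`re_map_kktForm_nonneg`). [cite: AraujoEtAl2023, §3.2 Prop. 11]
[cite: BratteliRobinsonII1997, Prop. 5.3.19] -/
theorem re_orbitState_kktForm_nonneg_of_sectorGS {A : Matrix n n ℂ} (hA : A.IsHermitian)
    (K : Submodule ℂ (n → ℂ)) {T : Gp → Matrix n n ℂ} (hTA : ∀ g, T g * A = A * T g)
    (hTK : ∀ g, ∀ w ∈ K, (T g)ᴴ *ᵥ w ∈ K) {ψ : n → ℂ} (hψK : ψ ∈ K)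
    (hAψ : A *ᵥ ψ = ((A.minEnergyOn K : ℝ) : ℂ) • ψ) {Gm : Matrix m m ℂ} (hG : Gm.PosSemidef)
    (B : m → Matrix n n ℂ) (hB : ∀ j, ∀ w ∈ K, B j *ᵥ w ∈ K) :
    0 ≤ (orbitState T ψ (kktForm A Gm B)).re :=
  re_map_kktForm_nonneg _ A hG B fun c => by
    rw [Matrix.star_eq_conjTranspose]
    exact re_orbitState_conjTranspose_mul_commutator_nonneg_of_sectorGS hA K (fun w hw => by
      rw [Matrix.sum_mulVec]
      exact K.sum_mem fun j _ => by rw [Matrix.smul_mulVec]; exact K.smul_mem _ (hB j w hw))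
      hTA hTK hψK hAψ

end OrbitKKT

/-! ## §2 The `t–t'` tori: window certificate rows with a KKT summand, every sector ground state -/

section TorusTT

variable {L : ℕ} [NeZero L]

/-- (Local to this section, as in `HubbardNNNHoppingCorrelatorWindowCertificate`.) [folklore] -/
local instance (priority := high) instDecidableEqFermionTorusKKTTT : DecidableEq (FermionTorus 2 L) :=
  LinearOrder.toDecidableEq

/-- Moving a summand of the right-hand side of a certificate identity into the objective:
`X − c − S − K = R + k ⇒ (X − k) − c − S − K = R`. [folklore] -/
private theorem cert_sub_kkt_TT {A : Type*} [AddCommGroup A] {X c S K R k : A}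
    (h : X - c - S - K = R + k) : X - k - c - S - K = R := by
  rw [eq_sub_of_add_eq h.symm]
  abel

/-- **The window KKT element is nonnegative in the orbit state of every sector ground state of the
`t–t'` torus.** Regions `Λ ⊆ Λ'` with `thicken Λ 1 ⊆ Λ'`, `x ↦ x mod L` injective on
`thicken Λ' 1`; generators `B_b ∈ 𝔄_Λ` conserving the local `N̂` and `S^z`; `G ⪰ 0`; `S ⊆ D₄` any
finite set; `ψ` a ground state of the sector `(2n, S^z = 0)` of `hubbardTorusTT' L t t' U`. Then
`0 ≤ Re ω̄_ψ(Γ(ι_{Λ',L}) kktForm H^{tt'}_{Λ'} G (Γ(incl) ∘ B))`, `ω̄_ψ = orbitState (U_w D_γ) ψ`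
(`hubbardTorusTT'_commutator_fermionEmbed`; `U_w D_γ` commute with `H` and preserve the sectors,
`spaceGroupUnitary_mul_hubbardTorusTT'`, `d4Affine_conjTranspose_mulVec_mem_szSector`; `ΓB̃`
preserves the sector). [cite: BratteliRobinsonII1997, Prop. 5.3.19] [cite: ScheerEtAl2025, §II eq. (2)] -/
theorem re_orbitState_fermionEmbed_kktForm_TT'_nonneg (t t' U : ℝ) {nh : ℕ}
    {Λ Λ' : Finset (Site 2)} (hΛ : Λ ⊆ Λ') (h8 : thicken Λ 1 ⊆ Λ')
    (hInj : Set.InjOn (Torus.proj (d := 2) L) ↑(thicken Λ' 1))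
    (hInj' : Set.InjOn (Torus.proj (d := 2) L) ↑Λ') (S : Finset (DihedralGroup 4))
    {ψ : Fock (Orb (FermionTorus 2 L))}
    (hGS : IsGroundStateInSector (hubbardTorusTT' L t t' U) (2 * nh) 0 ψ)
    {β : Type*} [Fintype β] [DecidableEq β] {G : Matrix β β ℂ} (hG : G.PosSemidef)
    (Bk : β → FermionOp Λ) (hBN : ∀ b, Commute (Bk b) totalNumber)
    (hBS : ∀ b, Commute (Bk b) HubbardWave0.spinZ) :
    0 ≤ (orbitState (spaceGroupUnitary S) ψ
        (fermionEmbed (PolySite.toTorusEmb L hInj')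
          (kktForm ((hubbardTTPrimeFermionInteraction t t' U).localHamiltonian Λ') G
            (fun b => fermionEmbed (PolySite.incl hΛ) (Bk b))))).re := by
  have hInjΛ : Set.InjOn (Torus.proj (d := 2) L) ↑Λ := hInj'.mono (by exact_mod_cast hΛ)
  have hH : (hubbardTorusTT' L t t' U).IsHermitian := hubbardTorusTT'_isHermitian L t t' U
  set ω' : FermionOp Λ' →ₗ[ℂ] ℂ :=
    orbitState (spaceGroupUnitary S) ψ ∘ₗ (fermionEmbed (PolySite.toTorusEmb L hInj')).toLinearMap
    with hω'
  have hω'app : ∀ x, ω' x = orbitState (spaceGroupUnitary S) ψ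
      (fermionEmbed (PolySite.toTorusEmb L hInj') x) := fun _ => rfl
  have h := re_map_kktForm_nonneg ω' ((hubbardTTPrimeFermionInteraction t t' U).localHamiltonian Λ')
    hG (fun b => fermionEmbed (PolySite.incl hΛ) (Bk b)) fun wc => ?_
  · rwa [hω'app] at h
  -- the ground-state inequality for the generator `C = Γ(Σ_b wc_b B_b)`
  have hsum : ∑ j, wc j • fermionEmbed (PolySite.incl hΛ) (Bk j) =
      fermionEmbed (PolySite.incl hΛ) (∑ j, wc j • Bk j) := by
    rw [fermionEmbed_sum]
    exact Finset.sum_congr rfl fun j _ => (fermionEmbed_smul _ _ _).symm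
  have hAwN : Commute (∑ j, wc j • Bk j) totalNumber :=
    Commute.sum_left _ _ _ fun j _ => Commute.smul_left (hBN j) _
  have hAwS : Commute (∑ j, wc j • Bk j) HubbardWave0.spinZ :=
    Commute.sum_left _ _ _ fun j _ => Commute.smul_left (hBS j) _
  have hB : fermionEmbed (PolySite.toTorusEmb L hInj') (fermionEmbed (PolySite.incl hΛ) (∑ j, wc j • Bk j)) =
      fermionEmbed (PolySite.toTorusEmb L hInjΛ) (∑ j, wc j • Bk j) := by
    rw [fermionEmbed_fermionEmbed]
    exact congrFun (congrArg DFunLike.coe (fermionEmbed_congr fun p => rfl)) _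
  rw [hsum, hω'app, Matrix.star_eq_conjTranspose, fermionEmbed_mul, fermionEmbed_conjTranspose,
    ← hubbardTorusTT'_commutator_fermionEmbed L t t' U hΛ h8 hInj (∑ j, wc j • Bk j), hB]
  exact re_orbitState_conjTranspose_mul_commutator_nonneg_of_sectorGS hH (szSector (2 * nh) 0)
    (fun v hv => mulVec_mem_szSector_of_commute (commute_fermionEmbed_toTorusEmb_totalNumber L hInjΛ hAwN)
      (commute_fermionEmbed_toTorusEmb_spinZ L hInjΛ hAwS) hv)
    (fun g => spaceGroupUnitary_mul_hubbardTorusTT' S t t' U g)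
    (fun g w hw => d4Affine_conjTranspose_mulVec_mem_szSector _ _ hw) hGS.1 hGS.2.2

/-- **`t–t'` window certificate with energy constraint, affine `D₄` reductions AND a KKT block ⇒
space-group-averaged expectation of a local observable in every sector GROUND state of every large
torus.** Data as in `re_orbitState_ge_of_window_certificate_d4_TT'_ineq`
(HubbardNNNHoppingCorrelatorWindowCertificate) plus a multiplier `G ⪰ 0` and generators
`B_b ∈ 𝔄_Λ` with `[B_b, N̂_Λ] = [B_b, S^z_Λ] = 0`; the identity in `𝔄_{Λ'}` carries the extra summand
`+ kktForm H^{tt'}_{Λ'} G (Γ(incl) ∘ B)` on the right. Then for every `L ≥ 3` with `x ↦ x mod L`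
injective on `thicken Λ' 1`, every `n ≤ L²`, every finite `S ∋ 1` closed under multiplication with
`γₗ ∈ S`, and every unit GROUND state `ψ` of the sector `(2n, S^z = 0)` of `hubbardTorusTT' L t t' U`:
`c − Σₖ ‖aₖ‖ + (Σ_σ μ_σ)(n/L² − ν) + κ (u − E₀(2n)/L²) ≤ Re ω̄_ψ(Γ(ι_{Λ',L}) X)`,
`E₀(2n) = groundEnergy (hubbardTorusTT' L t t' U) (2n)`. (The row without the block for the objective
`X − kktForm …`, plus `re_orbitState_fermionEmbed_kktForm_TT'_nonneg`.) [cite: WangEtAl2024, §III]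
[cite: Han2020Bootstrap, §3] [cite: ScheerEtAl2025, §II eq. (2)] -/
theorem re_orbitState_ge_of_window_certificate_d4_TT'_kkt_ineq (t t' U : ℝ) (hL : 3 ≤ L)
    {nh : ℕ} (hn : nh ≤ Fintype.card (FermionTorus 2 L))
    {Λ Λ' : Finset (Site 2)} (hΛ : Λ ⊆ Λ') (h8 : thicken Λ 1 ⊆ Λ')
    (h0 : thicken ({0} : Finset (Site 2)) 1 ⊆ Λ') (hz : (0 : Site 2) ∈ Λ')
    (hInj : Set.InjOn (Torus.proj (d := 2) L) ↑(thicken Λ' 1))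
    (hInj' : Set.InjOn (Torus.proj (d := 2) L) ↑Λ')
    {S : Finset (DihedralGroup 4)} (h1 : (1 : DihedralGroup 4) ∈ S) (hmul : ∀ a ∈ S, ∀ b ∈ S, a * b ∈ S)
    {ψ : Fock (Orb (FermionTorus 2 L))}
    (hGS : IsGroundStateInSector (hubbardTorusTT' L t t' U) (2 * nh) 0 ψ) (hψ1 : star ψ ⬝ᵥ ψ = 1)
    (Xw : FermionOp Λ') (κ u : ℝ) (μ : Fin 2 → ℝ) (ν : ℝ)
    {m : Type*} [Fintype m] [DecidableEq m] {Λm : Matrix m m ℂ} (hΛm : Λm.PosSemidef)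
    (O : m → FermionOp Λ')
    {κ' : Type*} (s : Finset κ') (B : κ' → FermionOp Λ)
    {ι : Type*} (tt : Finset ι) (γ : ι → DihedralGroup 4) (hγS : ∀ l ∈ tt, γ l ∈ S) (wv : ι → Site 2)
    (hsh : ∀ l, d4ShiftSet (γ l) (wv l) Λ ⊆ Λ') (Y : ι → FermionOp Λ)
    {ρ : Type*} (uu : Finset ρ) (b : ρ → ℂ) (cw : ρ → List (Orb (PolySite Λ') × Bool))
    (hcw : ∀ j ∈ uu, ladderCharge (cw j) ≠ 0 ∨ ladderSpinCharge (cw j) ≠ 0)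
    {δ : Type*} (ah : Finset δ) (dc : δ → ℝ) (V : δ → FermionOp Λ')
    {κ'' : Type*} (w : Finset κ'') (a : κ'' → ℂ) (word : κ'' → List (Orb (PolySite Λ') × Bool))
    {β : Type*} [Fintype β] [DecidableEq β] {G : Matrix β β ℂ} (hG : G.PosSemidef)
    (Bk : β → FermionOp Λ) (hBN : ∀ b', Commute (Bk b') totalNumber)
    (hBS : ∀ b', Commute (Bk b') HubbardWave0.spinZ) {c : ℝ}
    (hcert : Xw - (c : ℂ) • (1 : FermionOp Λ') -
        ∑ σ : Fin 2, ((μ σ : ℝ) : ℂ) • (nAt 0 hz σ - ((ν : ℝ) : ℂ) • (1 : FermionOp Λ')) -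
        ((κ : ℝ) : ℂ) • (((u : ℝ) : ℂ) • (1 : FermionOp Λ') -
          fermionEmbed (PolySite.incl h0) ((hubbardTTPrimeFermionInteraction t t' U).meanEnergyObs 1)) =
      gramForm Λm O +
        (∑ k ∈ s, ((hubbardTTPrimeFermionInteraction t t' U).localHamiltonian Λ' * fermionEmbed (PolySite.incl hΛ) (B k) -
            fermionEmbed (PolySite.incl hΛ) (B k) * (hubbardTTPrimeFermionInteraction t t' U).localHamiltonian Λ') +
          ∑ l ∈ tt, (fermionEmbed (PolySite.incl (hsh l)) (fermionEmbed (PolySite.d4Emb (γ l) (wv l) Λ) (Y l)) -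
            fermionEmbed (PolySite.incl hΛ) (Y l)) +
          ∑ j ∈ uu, b j • ladderWord (cw j)) +
        (∑ m' ∈ ah, ((dc m' : ℝ) : ℂ) • ((V m')ᴴ - V m') + ∑ k ∈ w, a k • ladderWord (word k)) +
        kktForm ((hubbardTTPrimeFermionInteraction t t' U).localHamiltonian Λ') G
          (fun b' => fermionEmbed (PolySite.incl hΛ) (Bk b'))) :
    c - ∑ k ∈ w, ‖a k‖ + (∑ σ : Fin 2, μ σ) * ((nh : ℝ) / (L : ℝ) ^ 2 - ν) +
        κ * (u - groundEnergy (hubbardTorusTT' L t t' U) (2 * nh) / (L : ℝ) ^ 2) ≤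
      (orbitState (spaceGroupUnitary S) ψ (fermionEmbed (PolySite.toTorusEmb L hInj') Xw)).re := by
  have hHψ : hubbardTorusTT' L t t' U *ᵥ ψ =
      ((groundEnergy (hubbardTorusTT' L t t' U) (2 * nh) : ℝ) : ℂ) • ψ := by
    rw [groundEnergy_hubbardTorusTT'_eq_minEnergyOn_szSector L t t' U hn]
    exact hGS.2.2
  -- the row WITHOUT the block, for the objective `X − kktForm …`
  have hmain := re_orbitState_ge_of_window_certificate_d4_TT'_ineq t t' U hL hΛ h8 h0 hz hInj hInj' h1 hmul
    hGS.1 hψ1 hHψ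
    (Xw - kktForm ((hubbardTTPrimeFermionInteraction t t' U).localHamiltonian Λ') G
      (fun b' => fermionEmbed (PolySite.incl hΛ) (Bk b'))) κ u μ ν hΛm O s B tt γ hγS wv hsh Y uu b cw
    hcw ah dc V w a word (cert_sub_kkt_TT hcert)
  -- the block is a nonnegative residual in the orbit state of the ground state
  have hkkt := re_orbitState_fermionEmbed_kktForm_TT'_nonneg t t' U hΛ h8 hInj hInj' S hGS hG Bk hBN hBS
  rw [map_sub, map_sub, Complex.sub_re] at hmain
  linarith

/-- **For every ground state of the sector, with the energy hypothesis.** Under the hypotheses of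
`re_orbitState_ge_of_window_certificate_d4_TT'_kkt_ineq` with `κ ≥ 0` and a (certified) upper bound
`groundEnergy (hubbardTorusTT' L t t' U) (2n) / L² ≤ u`, EVERY unit ground state `ψ` of the sector
`(2n, S^z = 0)` — every vector of a degenerate ground level — obeys
`c − Σₖ ‖aₖ‖ + (Σ_σ μ_σ)(n/L² − ν) ≤ Re ω̄_ψ(Γ(ι_{Λ',L}) X)`, uniformly in `L`.
[cite: WangEtAl2024, §III] [cite: ScheerEtAl2025, §II eq. (2)] -/
theorem re_orbitState_ge_of_window_certificate_d4_TT'_groundState_kkt (t t' U : ℝ) (hL : 3 ≤ L)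
    {nh : ℕ} (hn : nh ≤ Fintype.card (FermionTorus 2 L))
    {Λ Λ' : Finset (Site 2)} (hΛ : Λ ⊆ Λ') (h8 : thicken Λ 1 ⊆ Λ')
    (h0 : thicken ({0} : Finset (Site 2)) 1 ⊆ Λ') (hz : (0 : Site 2) ∈ Λ')
    (hInj : Set.InjOn (Torus.proj (d := 2) L) ↑(thicken Λ' 1))
    (hInj' : Set.InjOn (Torus.proj (d := 2) L) ↑Λ')
    {S : Finset (DihedralGroup 4)} (h1 : (1 : DihedralGroup 4) ∈ S) (hmul : ∀ a ∈ S, ∀ b ∈ S, a * b ∈ S)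
    {ψ : Fock (Orb (FermionTorus 2 L))}
    (hGS : IsGroundStateInSector (hubbardTorusTT' L t t' U) (2 * nh) 0 ψ) (hψ1 : star ψ ⬝ᵥ ψ = 1)
    {κ u : ℝ} (hκ : 0 ≤ κ) (hu : groundEnergy (hubbardTorusTT' L t t' U) (2 * nh) / (L : ℝ) ^ 2 ≤ u)
    (Xw : FermionOp Λ') (μ : Fin 2 → ℝ) (ν : ℝ)
    {m : Type*} [Fintype m] [DecidableEq m] {Λm : Matrix m m ℂ} (hΛm : Λm.PosSemidef)
    (O : m → FermionOp Λ')
    {κ' : Type*} (s : Finset κ') (B : κ' → FermionOp Λ)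
    {ι : Type*} (tt : Finset ι) (γ : ι → DihedralGroup 4) (hγS : ∀ l ∈ tt, γ l ∈ S) (wv : ι → Site 2)
    (hsh : ∀ l, d4ShiftSet (γ l) (wv l) Λ ⊆ Λ') (Y : ι → FermionOp Λ)
    {ρ : Type*} (uu : Finset ρ) (b : ρ → ℂ) (cw : ρ → List (Orb (PolySite Λ') × Bool))
    (hcw : ∀ j ∈ uu, ladderCharge (cw j) ≠ 0 ∨ ladderSpinCharge (cw j) ≠ 0)
    {δ : Type*} (ah : Finset δ) (dc : δ → ℝ) (V : δ → FermionOp Λ')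
    {κ'' : Type*} (w : Finset κ'') (a : κ'' → ℂ) (word : κ'' → List (Orb (PolySite Λ') × Bool))
    {β : Type*} [Fintype β] [DecidableEq β] {G : Matrix β β ℂ} (hG : G.PosSemidef)
    (Bk : β → FermionOp Λ) (hBN : ∀ b', Commute (Bk b') totalNumber)
    (hBS : ∀ b', Commute (Bk b') HubbardWave0.spinZ) {c : ℝ}
    (hcert : Xw - (c : ℂ) • (1 : FermionOp Λ') -
        ∑ σ : Fin 2, ((μ σ : ℝ) : ℂ) • (nAt 0 hz σ - ((ν : ℝ) : ℂ) • (1 : FermionOp Λ')) -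
        ((κ : ℝ) : ℂ) • (((u : ℝ) : ℂ) • (1 : FermionOp Λ') -
          fermionEmbed (PolySite.incl h0) ((hubbardTTPrimeFermionInteraction t t' U).meanEnergyObs 1)) =
      gramForm Λm O +
        (∑ k ∈ s, ((hubbardTTPrimeFermionInteraction t t' U).localHamiltonian Λ' * fermionEmbed (PolySite.incl hΛ) (B k) -
            fermionEmbed (PolySite.incl hΛ) (B k) * (hubbardTTPrimeFermionInteraction t t' U).localHamiltonian Λ') +
          ∑ l ∈ tt, (fermionEmbed (PolySite.incl (hsh l)) (fermionEmbed (PolySite.d4Emb (γ l) (wv l) Λ) (Y l)) -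
            fermionEmbed (PolySite.incl hΛ) (Y l)) +
          ∑ j ∈ uu, b j • ladderWord (cw j)) +
        (∑ m' ∈ ah, ((dc m' : ℝ) : ℂ) • ((V m')ᴴ - V m') + ∑ k ∈ w, a k • ladderWord (word k)) +
        kktForm ((hubbardTTPrimeFermionInteraction t t' U).localHamiltonian Λ') G
          (fun b' => fermionEmbed (PolySite.incl hΛ) (Bk b'))) :
    c - ∑ k ∈ w, ‖a k‖ + (∑ σ : Fin 2, μ σ) * ((nh : ℝ) / (L : ℝ) ^ 2 - ν) ≤
      (orbitState (spaceGroupUnitary S) ψ (fermionEmbed (PolySite.toTorusEmb L hInj') Xw)).re := by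
  have h := re_orbitState_ge_of_window_certificate_d4_TT'_kkt_ineq t t' U hL hn hΛ h8 h0 hz hInj hInj' h1 hmul
    hGS hψ1 Xw κ u μ ν hΛm O s B tt γ hγS wv hsh Y uu b cw hcw ah dc V w a word hG Bk hBN hBS hcert
  have hslack : 0 ≤ κ * (u - groundEnergy (hubbardTorusTT' L t t' U) (2 * nh) / (L : ℝ) ^ 2) :=
    mul_nonneg hκ (sub_nonneg.2 hu)
  linarith

end TorusTT

end Summit.HubbardSuperconductivity.HubbardLadder

end
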